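import Mathlib

/-!
# Tower graft line — THE SWAP-LETTER FIBRE: Jacobi's corner identity, folds of a rank-2 indefinite graft are class events

Mechanism file for the line `Cruxes/WeakLifting/Lines/tower_graft.lean` (crux `WeakLifting` = stmt-ValiantsHypothesis-19561,
restricted sub-case `TowerWeakLifting`; S5 side — the INDEFINITE far letter).  MECHANISM LEMMA: no registered stub closes by it;
the line planner names it the piece «SWAP-LETTER FOLDS ARE CLASS EVENTS» (val-idea-24, 17:57:32Z; desk R2720 (A)).  Companion of
`…TowerGraftResidualDeterminant.lean` / `…TowerGraftRankOneGraft.lean` (rank-one far letters closed in class form): the first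
indefinite far letter beyond rank one is the SWAP letter `E_ab + E_ba` (signature `(1,1)`), which is also what the bordered-minor
recursion produces from rank `≥ 2` and identity grafts (seat memo RESIDUAL-DETERMINANT-liftp3g16.md §3, evidence #51 on 19561).

* §1 `adjugate_corner_two` — **Jacobi's identity for the `2×2` corner of the adjugate** over a commutative domain (`det A ≠ 0`):
  `adj A 0 0 · adj A 1 1 − adj A 1 0 · adj A 0 1 = det A · det A_{01,01}` (proof: `A · X = A` with columns `0,1` replaced by
  `det A·e₀, det A·e₁`, where `X` is the identity with columns `0,1` replaced by those of `adj A`; determinants by two Laplace steps).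
* §2 `det_add_smul_swap` — the FIBRE of the swap graft is the quadratic
  `det (G + t·(E₀₁ + E₁₀)) = det G + t·(adj G 1 0 + adj G 0 1) − t²·det G_{01,01}` (row multilinearity; any commutative ring), and
  `swap_discriminant` — for symmetric `G` its discriminant is `4·adj G 0 0·adj G 1 1`, the product of the two principal `(m+1)`-minors:
  the FOLD points (where the two real fibre branches merge) of the swap graft `t = X^D` are zeros of CLASS determinants on the same
  support — an exact instance of the fold budget (T3) of the line's S5 memo `Lines/tower_graft-S5.md`, which is open in general.

PRIOR ART in the tree: the Rolle–Schur files (`…RolleSchurStep/Compression.lean`, p586469) and the graft calculus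
(`…GraftLaw/GraftToolkit/TailGraft*.lean`); Jacobi's complementary-minor theorem is classical [folklore] (not found in Mathlib for
`2×2` minors of the adjugate; proved here from `Matrix.mul_adjugate`).  Def-free; Mathlib only.  HONEST FRAMING: exact algebra for ONE
indefinite rank-2 far letter; it bounds nothing by itself (the per-branch count between folds is the open T1/T2 part), and says
nothing about S4/S4b/S4d/S5, `WeakLifting`, Conjecture B, `MatrixDescartes` (18050) or `VP ≠ VNP`.
Seat: prover val-sym-lift-p3 g16, `--supports stmt-ValiantsHypothesis-19561`.  Exact cross-check: deposit `tools/check_swap.py`.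
-/

-- `Summit.ValiantsHypothesis.ValiantsHypothesis.…` repeats a component by the D-0017 layout
-- (single-conjunct summit), which the `dupNamespace` linter flags; the name is mandated.
set_option linter.dupNamespace false

namespace Summit.ValiantsHypothesis.ValiantsHypothesis.Theorems.KPlusLogSqLaw.TowerGraft

open Finset Polynomial Matrix
open scoped BigOperators Polynomial

/-! ## §1 Jacobi's identity for the `2 × 2` corner of the adjugate

For `A : Matrix (Fin (m+2)) (Fin (m+2)) R` over a commutative domain with `det A ≠ 0`:
`adj A 0 0 · adj A 1 1 − adj A 0 1 · adj A 1 0 = det A · det A_{01,01}` (`A_{01,01}` deletes rows and columns `0,1`).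
Proof: with `X = 1` whose columns `0,1` are replaced by those of `adj A`, `A · X` is `A` with columns `0,1` replaced by
`det A · e₀`, `det A · e₁`; take determinants. -/

section Jacobi

variable {R : Type*} [CommRing R] {m : ℕ}

/-- the identity with column `0` replaced has determinant the diagonal entry of the new column. [folklore] -/
theorem det_one_updateCol_zero {k : ℕ} (w : Fin (k + 1) → R) :
    ((1 : Matrix (Fin (k + 1)) (Fin (k + 1)) R).updateCol 0 w).det = w 0 := by
  rw [← Matrix.cramer_apply, Matrix.cramer_one]
  simp

/-- `det` of the identity with columns `0, 1` replaced by `u, v`: `u₀ v₁ − u₁ v₀`. [folklore] -/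
theorem det_one_updateCol_zero_one (u v : Fin (m + 2) → R) :
    ((((1 : Matrix (Fin (m + 2)) (Fin (m + 2)) R).updateCol 0 u).updateCol 1 v)).det = u 0 * v 1 - u 1 * v 0 := by
  set M := (((1 : Matrix (Fin (m + 2)) (Fin (m + 2)) R).updateCol 0 u).updateCol 1 v) with hM
  rw [Matrix.det_succ_row_zero, Fin.sum_univ_succ, Fin.sum_univ_succ]
  -- the tail vanishes: row `0` of `M` is `(u 0, v 0, 0, …, 0)`
  have htail : ∑ j : Fin m, (-1 : R) ^ ((j.succ.succ : Fin (m + 2)) : ℕ) * M 0 j.succ.succ *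
      (M.submatrix Fin.succ (Fin.succAbove j.succ.succ)).det = 0 := by
    refine Finset.sum_eq_zero fun j _ => ?_
    have hj1 : j.succ.succ ≠ (1 : Fin (m + 2)) := Fin.succ_succ_ne_one j
    have hj0 : j.succ.succ ≠ (0 : Fin (m + 2)) := Fin.succ_ne_zero _
    have h0 : M 0 j.succ.succ = 0 := by
      simp [hM, hj1, hj0, hj0.symm]
    rw [h0, mul_zero, zero_mul]
  -- the two minors are identities with one column replaced
  have h1 : M.submatrix Fin.succ (Fin.succAbove (0 : Fin (m + 2))) =
      (1 : Matrix (Fin (m + 1)) (Fin (m + 1)) R).updateCol 0 (fun i => v i.succ) := by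
    refine Matrix.ext fun i j => ?_
    rcases eq_or_ne j 0 with rfl | hj
    · simp [hM]
    · obtain ⟨j', rfl⟩ := Fin.exists_succ_eq.2 hj
      have hj1 : j'.succ.succ ≠ (1 : Fin (m + 2)) := Fin.succ_succ_ne_one j'
      simp [hM, Fin.succ_ne_zero, Matrix.one_apply, hj1, Fin.succ_inj]
  have h2 : M.submatrix Fin.succ (Fin.succAbove (1 : Fin (m + 2))) =
      (1 : Matrix (Fin (m + 1)) (Fin (m + 1)) R).updateCol 0 (fun i => u i.succ) := by
    refine Matrix.ext fun i j => ?_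
    rcases eq_or_ne j 0 with rfl | hj
    · simp [hM]
    · obtain ⟨j', rfl⟩ := Fin.exists_succ_eq.2 hj
      have hsa : Fin.succAbove (1 : Fin (m + 2)) j'.succ = j'.succ.succ := by
        have : (1 : Fin (m + 2)) = (0 : Fin (m + 1)).succ := rfl
        rw [this, Fin.succ_succAbove_succ, Fin.succAbove_zero]
      have hj1 : j'.succ.succ ≠ (1 : Fin (m + 2)) := Fin.succ_succ_ne_one j'
      have hj0 : j'.succ.succ ≠ (0 : Fin (m + 2)) := Fin.succ_ne_zero _
      simp [hM, hsa, hj1, hj0, Matrix.one_apply, Fin.succ_inj]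
  have hsa1 : (Fin.succ (0 : Fin (m + 1))) = (1 : Fin (m + 2)) := rfl
  rw [htail, add_zero, h1, hsa1, h2, det_one_updateCol_zero, det_one_updateCol_zero]
  simp [hM]
  ring

/-- `A · X`, `X` = the identity with columns `0,1` replaced by those of `adj A`, is `A` with columns `0,1` replaced by
`det A · e₀`, `det A · e₁`. [folklore] -/
theorem mul_one_updateCol_adjugate (A : Matrix (Fin (m + 2)) (Fin (m + 2)) R) :
    A * (((1 : Matrix (Fin (m + 2)) (Fin (m + 2)) R).updateCol 0 (fun i => A.adjugate i 0)).updateCol 1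
        (fun i => A.adjugate i 1)) =
      (A.updateCol 0 (A.det • (Pi.single 0 1 : Fin (m + 2) → R))).updateCol 1
        (A.det • (Pi.single 1 1 : Fin (m + 2) → R)) := by
  have hadj : ∀ i j, ∑ k, A i k * A.adjugate k j = if i = j then A.det else 0 := by
    intro i j
    have h := congrFun (congrFun (Matrix.mul_adjugate A) i) j
    simpa [Matrix.mul_apply, Matrix.smul_apply, Matrix.one_apply] using h
  refine Matrix.ext fun i j => ?_
  simp only [Matrix.mul_apply, Matrix.updateCol_apply]
  by_cases hj1 : j = 1
  · subst hj1
    simp [hadj, Pi.single_apply]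
  · by_cases hj0 : j = 0
    · subst hj0
      simp [hadj, Pi.single_apply]
    · simp [hj1, hj0, Matrix.one_apply]

/-- `det` of `A` with columns `0,1` replaced by `c·e₀`, `c·e₁` is `c² · det A_{01,01}`. [folklore] -/
theorem det_updateCol_zero_one_smul_single (A : Matrix (Fin (m + 2)) (Fin (m + 2)) R) (c : R) :
    ((A.updateCol 0 (c • (Pi.single 0 1 : Fin (m + 2) → R))).updateCol 1
        (c • (Pi.single 1 1 : Fin (m + 2) → R))).det =
      c * (c * (A.submatrix (Fin.succ ∘ Fin.succ) (Fin.succ ∘ Fin.succ)).det) := by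
  set M := (A.updateCol 0 (c • (Pi.single 0 1 : Fin (m + 2) → R))).updateCol 1
        (c • (Pi.single 1 1 : Fin (m + 2) → R)) with hM
  rw [Matrix.det_succ_column_zero, Fin.sum_univ_succ]
  have htail : ∑ i : Fin (m + 1), (-1 : R) ^ ((i.succ : Fin (m + 2)) : ℕ) * M i.succ 0 *
      (M.submatrix (Fin.succAbove i.succ) Fin.succ).det = 0 := by
    refine Finset.sum_eq_zero fun i _ => ?_
    have h0 : M i.succ 0 = 0 := by simp [hM, Fin.succ_ne_zero]
    rw [h0, mul_zero, zero_mul]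
  have h1 : M.submatrix (Fin.succAbove (0 : Fin (m + 2))) Fin.succ =
      (A.submatrix Fin.succ Fin.succ).updateCol 0 (c • (Pi.single 0 1 : Fin (m + 1) → R)) := by
    have hsucc1 : ∀ i : Fin (m + 1), (i.succ = (1 : Fin (m + 2))) ↔ i = 0 := fun i => by
      rw [show (1 : Fin (m + 2)) = Fin.succ 0 from rfl, Fin.succ_inj]
    refine Matrix.ext fun i j => ?_
    rcases eq_or_ne j 0 with rfl | hj
    · simp [hM, Pi.single_apply, hsucc1]
    · obtain ⟨j', rfl⟩ := Fin.exists_succ_eq.2 hj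
      have hj1 : j'.succ.succ ≠ (1 : Fin (m + 2)) := Fin.succ_succ_ne_one j'
      have hj0 : j'.succ.succ ≠ (0 : Fin (m + 2)) := Fin.succ_ne_zero _
      simp [hM, hj1, hj0, Fin.succ_ne_zero]
  have h2 : ((A.submatrix Fin.succ Fin.succ).updateCol 0 (c • (Pi.single 0 1 : Fin (m + 1) → R))).det =
      c * (A.submatrix (Fin.succ ∘ Fin.succ) (Fin.succ ∘ Fin.succ)).det := by
    rw [Matrix.det_succ_column_zero, Fin.sum_univ_succ]
    have htail' : ∑ i : Fin m, (-1 : R) ^ ((i.succ : Fin (m + 1)) : ℕ) *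
        ((A.submatrix Fin.succ Fin.succ).updateCol 0 (c • (Pi.single 0 1 : Fin (m + 1) → R))) i.succ 0 *
        ((((A.submatrix Fin.succ Fin.succ).updateCol 0 (c • (Pi.single 0 1 : Fin (m + 1) → R))).submatrix
          (Fin.succAbove i.succ) Fin.succ)).det = 0 := by
      refine Finset.sum_eq_zero fun i _ => ?_
      simp [Fin.succ_ne_zero]
    have hsub : ((A.submatrix Fin.succ Fin.succ).updateCol 0 (c • (Pi.single 0 1 : Fin (m + 1) → R))).submatrix
        (Fin.succAbove (0 : Fin (m + 1))) Fin.succ = A.submatrix (Fin.succ ∘ Fin.succ) (Fin.succ ∘ Fin.succ) := by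
      refine Matrix.ext fun i j => ?_
      simp [Fin.succ_ne_zero]
    rw [htail', add_zero, hsub]
    simp
  rw [htail, add_zero, h1, h2]
  simp [hM]

/-- **Jacobi's identity for the `2 × 2` corner of the adjugate** (commutative domain, `det A ≠ 0`):
`adj A 0 0 · adj A 1 1 − adj A 1 0 · adj A 0 1 = det A · det A_{01,01}`. [folklore] -/
theorem adjugate_corner_two [IsDomain R] (A : Matrix (Fin (m + 2)) (Fin (m + 2)) R) (hA : A.det ≠ 0) :
    A.adjugate 0 0 * A.adjugate 1 1 - A.adjugate 1 0 * A.adjugate 0 1 =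
      A.det * (A.submatrix (Fin.succ ∘ Fin.succ) (Fin.succ ∘ Fin.succ)).det := by
  have h := congrArg Matrix.det (mul_one_updateCol_adjugate A)
  rw [Matrix.det_mul, det_one_updateCol_zero_one, det_updateCol_zero_one_smul_single] at h
  exact mul_left_cancel₀ hA h

end Jacobi

/-! ## §2 The fibre of a SWAP-letter graft and its discriminant

`det (G + t·(E₀₁ + E₁₀)) = det G + t·(adj G 1 0 + adj G 0 1) − t²·det G_{01,01}`; for symmetric `G` the discriminant of this
quadratic in `t` is `4·(adj₀₁² + det G·det G_{01,01}) = 4·adj G 0 0·adj G 1 1` (Jacobi) — a product of two CLASS determinants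
(principal minors), so the fold points of the rank-2 indefinite swap graft are class events. -/

section SwapFibre

variable {R : Type*} [CommRing R] {m : ℕ}

/-- rows `0,1` replaced by `e₀ᵀ, e₁ᵀ`: the determinant is the complementary minor. [folklore] -/
theorem det_updateRow_zero_one_single (G : Matrix (Fin (m + 2)) (Fin (m + 2)) R) :
    ((G.updateRow 0 (Pi.single 0 1 : Fin (m + 2) → R)).updateRow 1 (Pi.single 1 1 : Fin (m + 2) → R)).det =
      (G.submatrix (Fin.succ ∘ Fin.succ) (Fin.succ ∘ Fin.succ)).det := by
  have h := det_updateCol_zero_one_smul_single Gᵀ 1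
  rw [one_smul, one_smul, one_mul, one_mul, Matrix.updateCol_transpose, Matrix.updateCol_transpose,
    Matrix.det_transpose, ← Matrix.transpose_submatrix, Matrix.det_transpose] at h
  exact h

/-- rows `0,1` replaced by `e₁ᵀ, e₀ᵀ` (swapped): minus the complementary minor. [folklore] -/
theorem det_updateRow_zero_one_single_swap (G : Matrix (Fin (m + 2)) (Fin (m + 2)) R) :
    ((G.updateRow 0 (Pi.single 1 1 : Fin (m + 2) → R)).updateRow 1 (Pi.single 0 1 : Fin (m + 2) → R)).det =
      -(G.submatrix (Fin.succ ∘ Fin.succ) (Fin.succ ∘ Fin.succ)).det := by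
  have h01 : (0 : Fin (m + 2)) ≠ 1 := by simp
  have hswap : (G.updateRow 0 (Pi.single 1 1 : Fin (m + 2) → R)).updateRow 1 (Pi.single 0 1 : Fin (m + 2) → R) =
      ((G.updateRow 0 (Pi.single 0 1 : Fin (m + 2) → R)).updateRow 1
        (Pi.single 1 1 : Fin (m + 2) → R)).submatrix (Equiv.swap (0 : Fin (m + 2)) 1) id := by
    refine Matrix.ext fun i j => ?_
    simp only [Matrix.submatrix_apply, id]
    rcases eq_or_ne i 0 with rfl | hi0
    · simp [Matrix.updateRow_apply, Equiv.swap_apply_left]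
    · rcases eq_or_ne i 1 with rfl | hi1
      · simp [Matrix.updateRow_apply, Equiv.swap_apply_right]
      · simp [Matrix.updateRow_apply, hi0, hi1, Equiv.swap_apply_of_ne_of_ne hi0 hi1]
  rw [hswap, Matrix.det_permute, Equiv.Perm.sign_swap h01, det_updateRow_zero_one_single]
  simp

/-- **the swap-letter fibre**: `det (G + t·(E₀₁ + E₁₀)) = det G + t·(adj G 1 0 + adj G 0 1) − t²·det G_{01,01}`. [this work] -/
theorem det_add_smul_swap (G : Matrix (Fin (m + 2)) (Fin (m + 2)) R) (t : R) :
    (G + t • (Matrix.single (0 : Fin (m + 2)) (1 : Fin (m + 2)) (1 : R) + Matrix.single 1 0 1)).det =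
      G.det + t * (G.adjugate 1 0 + G.adjugate 0 1) - t * t * (G.submatrix (Fin.succ ∘ Fin.succ) (Fin.succ ∘ Fin.succ)).det := by
  have h01 : (0 : Fin (m + 2)) ≠ 1 := by simp
  have hF : G + t • (Matrix.single (0 : Fin (m + 2)) (1 : Fin (m + 2)) (1 : R) + Matrix.single 1 0 1) =
      (G.updateRow 0 (G 0 + t • (Pi.single 1 1 : Fin (m + 2) → R))).updateRow 1
        (G 1 + t • (Pi.single 0 1 : Fin (m + 2) → R)) := by
    refine Matrix.ext fun i j => ?_
    rcases eq_or_ne i 0 with rfl | hi0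
    · simp [Matrix.updateRow_apply, Matrix.single, Pi.single_apply, h01, eq_comm]
    · rcases eq_or_ne i 1 with rfl | hi1
      · simp [Matrix.updateRow_apply, Matrix.single, Pi.single_apply, eq_comm]
      · simp [Matrix.updateRow_apply, Matrix.single, hi0, hi1, hi0.symm, hi1.symm]
  rw [hF, Matrix.det_updateRow_add, Matrix.det_updateRow_smul]
  -- first term: `det (G.updateRow 0 (G 0 + t e₁)) = det G + t · adj G 1 0`
  have hrow1 : (G.updateRow 0 (G 0 + t • (Pi.single 1 1 : Fin (m + 2) → R))) 1 = G 1 := by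
    simp
  have h1 : (G.updateRow 0 (G 0 + t • (Pi.single 1 1 : Fin (m + 2) → R))).updateRow 1 (G 1) =
      G.updateRow 0 (G 0 + t • (Pi.single 1 1 : Fin (m + 2) → R)) := by
    conv_lhs => rw [← hrow1]
    rw [Matrix.updateRow_eq_self]
  rw [h1, Matrix.det_updateRow_add, Matrix.updateRow_eq_self, Matrix.det_updateRow_smul, ← Matrix.adjugate_apply]
  -- second term: commute the two row updates
  rw [Matrix.updateRow_comm _ h01, Matrix.det_updateRow_add, Matrix.det_updateRow_smul]
  have hrow0 : (G.updateRow 1 (Pi.single 0 1 : Fin (m + 2) → R)) 0 = G 0 := by simp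
  have h2 : (G.updateRow 1 (Pi.single 0 1 : Fin (m + 2) → R)).updateRow 0 (G 0) =
      G.updateRow 1 (Pi.single 0 1 : Fin (m + 2) → R) := by
    conv_lhs => rw [← hrow0]
    rw [Matrix.updateRow_eq_self]
  rw [h2, ← Matrix.adjugate_apply, ← Matrix.updateRow_comm _ h01, det_updateRow_zero_one_single_swap]
  ring

/-- **fold points of the swap graft are class events** (symmetric `G`, commutative domain, `det G ≠ 0`): the discriminant of the
fibre quadratic `det G + 2t·adj G 0 1 − t²·det G_{01,01}` is `4·adj G 0 0·adj G 1 1`, the product of the two principal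
`(m+1)`-minors.  (The hypothesis `det G ≠ 0` is the generic case: over `ℝ[X]` it reads `det G ≢ 0`, i.e. «away from the identically
singular pencils»; the identity itself is polynomial and holds in general, not needed here.) [this work] -/
theorem swap_discriminant [IsDomain R] (G : Matrix (Fin (m + 2)) (Fin (m + 2)) R) (hG : G.IsSymm) (hdet : G.det ≠ 0) :
    (G.adjugate 1 0 + G.adjugate 0 1) ^ 2 + 4 * G.det * (G.submatrix (Fin.succ ∘ Fin.succ) (Fin.succ ∘ Fin.succ)).det =
      4 * (G.adjugate 0 0 * G.adjugate 1 1) := by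
  have hsym : G.adjugate 1 0 = G.adjugate 0 1 := by
    have h := hG.adjugate
    exact h.apply 0 1
  have hJ := adjugate_corner_two G hdet
  rw [hsym] at hJ ⊢
  linear_combination (-4 : R) * hJ

end SwapFibre

end Summit.ValiantsHypothesis.ValiantsHypothesis.Theorems.KPlusLogSqLaw.TowerGraft
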